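import Summits.CriticalPhenomena.PercolationContinuityZ3.Theorems.PercAnnulusCrossingIICTailDecoupling
import HarnessLib

/-!
# Kesten's IIC scheme with a far rider, VII: the UPPER source comparison and the upper decoupling at finite volume (lane RSW3, p1 gen 9)

builds on p205010 (kernel theorem, internal audit signed; external expert review pending) — not used here (every `p`, every `d`).

Seat `prim-rsw3-p1` (gen 9); memo `run/shared/lean/prim/rsw3/P1-QM.md` §22.4.  Helper file; no definitions, no sorries.  Parts II–III gave the
LOWER source comparison `P(G | CONN(C;n)) ≳ ϰ² P(G | A_n)`.  Kesten's cross-ratio bound (part XI′, `kernel_crossRatio_le_aspect`) is SYMMETRIC in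
the two sources, so the same finite-sum algebra (`source_comparison_of_crossRatio` of part II with the roles of the sources exchanged) bounds the
rider's law given the arm from a rim FROM ABOVE by its law given the arm from the origin:
* **`sq_mul_le_real_rider_siteToBoundary_mul_conn`** — `ϰ²·((1−J)·π(n))·max 0 (P(G ∩ CONN(H,X;n)) − J·γ_n(H,X)) ≤ P(G ∩ A_n)·γ_n(H,X)`;
* `level_one_upper_of_pointwise` — finite-sum algebra of the first level, upper direction;
* **`sq_mul_mul_sub_le_real_inter_rider`** — `J ≤ 1`: `ϰ²(1−J)·(P(E ∩ G ∩ A_n) − J₁π(n))·π(n) ≤ (ϰ²(1−J)·J·π(n) + P(G ∩ A_n))·P(E ∩ A_n)`.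
The limit form and the two-sided `ε`-statement are part VIII (`…IICFarTwoSided`).
References: H. Kesten, PTRF 73 (1986) §2 (eq. (22), Lemma (23)); D. Basu, A. Sapozhnikov, ECP 22 (2017) no. 26, §2 (2.5)–(2.8).
-/

noncomputable section

namespace Summit.CriticalPhenomena.PercolationContinuityZ3.Theorems.Crossing

open MeasureTheory Filter Topology Literature.Probability.Percolation Literature.Probability.LatticeModels
open Literature.Probability.Percolation.DCT16
open Summit.CriticalPhenomena.PercolationContinuityZ3.Theorems.SurfaceTension
open scoped Literature.Probability.Percolation

variable {d : ℕ}

/-! ## The upper source comparison -/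

/-- **UPPER SOURCE COMPARISON FOR FAR EVENTS**: under (A2)□(ϰ) at a general aspect, with the scales and junk `J` of
`sq_mul_le_real_rider_conn_mul_oneArmProb` (part II) and a rider `G` beyond `Λ(σ M₂ + 1)`:
`ϰ² · ((1 − J)·π_p(n)) · max 0 (P(G ∩ CONN(H,X;n)) − J·γ_n(H,X)) ≤ P(G ∩ {0 ↔ ∂ⁱⁿΛ(n)}) · γ_n(H,X)` — the law of a far event given the arm
from `X` off `H` is at most `ϰ⁻²` times its law given the arm from `0`, up to the junk (part II with the two sources exchanged).
[cite: Kesten1986, §2 eq. (22), Lemma (23)] [cite: BasuSapozhnikov2017ECP, §2 (2.5)–(2.8)] -/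
theorem sq_mul_le_real_rider_siteToBoundary_mul_conn (p : unitInterval) {ϰ : ℝ} (hϰ : 0 < ϰ)
    {σ τ : ℕ → ℕ} (hσ : ∀ m : ℕ, 1 ≤ m → m < σ m) (hστ : ∀ m : ℕ, 1 ≤ m → σ m < τ m)
    (hσm : Monotone σ) (hτm : Monotone τ)
    (hA2 : ∀ m : ℕ, 1 ≤ m → ∀ Z : Finset (Site d), box d (τ m) \ box d (m - 1) ⊆ Z →
      ∀ X : Finset (Site d), X ⊆ Z ∩ box d m → ∀ Y : Finset (Site d), Y ⊆ Z \ box d (τ m) →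
        ϰ * (bondPercolation (zdGraph d) p).real {ω | ∃ x ∈ X, ∃ s ∈ innerBoundary (zdGraph d) (box d (σ m)),
              ω ∈ openConnIn (↑Z : Set (Site d)) x s} *
          (bondPercolation (zdGraph d) p).real {ω | ∃ y ∈ Y, ∃ s ∈ innerBoundary (zdGraph d) (box d (σ m)),
              ω ∈ openConnIn (↑Z : Set (Site d)) y s} ≤
        (bondPercolation (zdGraph d) p).real {ω | ∃ x ∈ X, ∃ y ∈ Y, ω ∈ openConnIn (↑Z : Set (Site d)) x y})
    {m μ₁ μ₂ M₁ M₂ n : ℕ} (hm : 1 ≤ m) (hmμ : τ m + 2 ≤ σ μ₁) (hμ12 : τ μ₁ < σ μ₂) (hμM : μ₂ ≤ M₁)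
    (hM12 : τ M₁ < σ M₂) (hn : τ M₂ < n)
    {H X : Finset (Site d)} (hH : H ⊆ box d (m - 1)) (hX : X ⊆ box d m) (hXH : ∀ x ∈ X, x ∉ H)
    {G : Set (BondConfig (Site d))} {S : Finset (Sym2 (Site d))} (hG : DeterminedBy G ↑S)
    (hS : Disjoint S (box d (σ M₂ + 1)).sym2) :
    ϰ ^ 2 * ((1 - ϰ⁻¹ ^ 2 * ((bondPercolation (zdGraph d) p).real (boxCrossing d (σ μ₁) (σ μ₂)) +
        (bondPercolation (zdGraph d) p).real (boxCrossing d (σ M₁) (σ M₂)))) * oneArmProb d p n) *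
      max 0 ((bondPercolation (zdGraph d) p).real (G ∩ {ω : BondConfig (Site d) | ∃ x ∈ X, ∃ t ∈ innerBoundary (zdGraph d) (box d n),
            ω ∈ openConnIn ((↑(box d n) : Set (Site d)) \ ↑H) x t}) -
        ϰ⁻¹ ^ 2 * ((bondPercolation (zdGraph d) p).real (boxCrossing d (σ μ₁) (σ μ₂)) +
          (bondPercolation (zdGraph d) p).real (boxCrossing d (σ M₁) (σ M₂))) *
          (bondPercolation (zdGraph d) p).real {ω : BondConfig (Site d) | ∃ x ∈ X, ∃ t ∈ innerBoundary (zdGraph d) (box d n),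
            ω ∈ openConnIn ((↑(box d n) : Set (Site d)) \ ↑H) x t}) ≤
      (bondPercolation (zdGraph d) p).real (G ∩ siteToBoundary d n) *
        (bondPercolation (zdGraph d) p).real {ω : BondConfig (Site d) | ∃ x ∈ X, ∃ t ∈ innerBoundary (zdGraph d) (box d n),
            ω ∈ openConnIn ((↑(box d n) : Set (Site d)) \ ↑H) x t} := by
  classical
  have hσ0 := hσ m hm
  have hστ0 := hστ m hm
  have hmμ' : m < μ₁ := hσm.reflect_lt (by omega)
  have hμ₁ : 1 ≤ μ₁ := by omega
  have hσ1 := hσ μ₁ hμ₁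
  have hστ1 := hστ μ₁ hμ₁
  have hμ12' : μ₁ < μ₂ := hσm.reflect_lt (by omega)
  have hM1 : 1 ≤ M₁ := by omega
  have hσM1 := hσ M₁ hM1
  have hστM1 := hστ M₁ hM1
  have hM12' : M₁ < M₂ := hσm.reflect_lt (by omega)
  have hHμ : H ⊆ box d (μ₁ - 1) := hH.trans (box_mono d (by omega))
  have hXμ : X ⊆ box d μ₁ := hX.trans (box_mono d (by omega))
  have h0H : (∅ : Finset (Site d)) ⊆ box d (m - 1) := Finset.empty_subset _
  have h0X : ({0} : Finset (Site d)) ⊆ box d m := Finset.singleton_subset_iff.2 (zero_mem_box d m)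
  have h0XH : ∀ x ∈ ({0} : Finset (Site d)), x ∉ (∅ : Finset (Site d)) := fun x _ => Finset.notMem_empty x
  have hKC := sum_kernel_mul_conn_two_sided_aspect p hϰ hσ hστ hσm hτm hA2 hμ₁ hμ12 hμM hM12 hn hHμ hXμ hXH
  have hK0 := sum_kernel_mul_conn_two_sided_aspect p hϰ hσ hστ hσm hτm hA2 hμ₁ hμ12 hμM hM12 hn
    (h0H.trans (box_mono d (by omega))) (h0X.trans (box_mono d (by omega))) h0XH
  have hRC := sum_kernel_mul_rider_conn_two_sided_aspect p hϰ hσ hστ hσm hτm hA2 hμ₁ hμ12 hμM hM12 hn hHμ hXμ hXH hG hS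
  have hR0 := sum_kernel_mul_rider_conn_two_sided_aspect p hϰ hσ hστ hσm hτm hA2 hμ₁ hμ12 hμM hM12 hn
    (h0H.trans (box_mono d (by omega))) (h0X.trans (box_mono d (by omega))) h0XH hG hS
  rw [conn_empty_zero_eq] at hK0 hR0
  rw [show oneArmProb d p n = (bondPercolation (zdGraph d) p).real (siteToBoundary d n) from rfl]
  refine source_comparison_of_crossRatio
    (((box d (σ M₂)).powerset.filter (fun U => box d (σ M₁) ⊆ U)) ×ˢ (box d (σ M₂ + 1)).powerset)
    (fun D => ∀ r ∈ D.2, r ∉ box d (σ M₂)) (pow_pos hϰ 2).le ?_ ?_ ?_ ?_ ?_ ?_ ?_ hK0.1 hRC.1 hR0.2 hKC.2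
  · exact fun _ _ => measureReal_nonneg
  · exact fun _ _ => measureReal_nonneg
  · exact fun _ _ => measureReal_nonneg
  · exact fun _ _ => measureReal_nonneg
  · intro D hD hbad
    push Not at hbad
    obtain ⟨r, hr, hrb⟩ := hbad
    rw [Finset.mem_product, Finset.mem_filter, Finset.mem_powerset, Finset.mem_powerset] at hD
    exact le_antisymm ((measureReal_mono (fun ω hω => hω.2.1.2) (measure_ne_top _ _)).trans
      (real_dat_eq_zero_of_mem_box p (hσm hM12'.le) hD.1.1 hr hrb).le) measureReal_nonneg
  · intro D hD hbad
    push Not at hbad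
    obtain ⟨r, hr, hrb⟩ := hbad
    rw [Finset.mem_product, Finset.mem_filter, Finset.mem_powerset, Finset.mem_powerset] at hD
    exact le_antisymm ((measureReal_mono (fun ω hω => hω.2.1.2) (measure_ne_top _ _)).trans
      (real_dat_eq_zero_of_mem_box p (hσm hM12'.le) hD.1.1 hr hrb).le) measureReal_nonneg
  · intro D hD D' hD' hgD hgD'
    rw [Finset.mem_product, Finset.mem_filter, Finset.mem_powerset, Finset.mem_powerset] at hD hD'
    exact kernel_crossRatio_le_aspect p hϰ.le hσ hστ hA2 hm (c := σ μ₁ - 1) (s := σ μ₂) (a := σ M₁) (b := σ M₂)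
      (by omega) (by omega) (hσm hμM) (hσm hM12'.le) h0H h0X h0XH hH hX hXH
      hD.1.2 hD.1.1 hD.2 hgD hD'.1.2 hD'.1.1 hD'.2 hgD'

/-! ## First level, upper direction -/

/-- **First level, upper direction, abstract**: weights `w ≥ 0` vanishing off `good`, pointwise `K·g_i ≤ Λ·γ_i` on good data, and the one-level
inequalities `P_{E,G} − J₁π ≤ Σ w g`, `Σ w γ ≤ P_E` give `K·(P_{E,G} − J₁π) ≤ Λ·P_E` (`K, Λ ≥ 0`). [cite: Kesten1986, §2 eq. (22)] -/
theorem level_one_upper_of_pointwise {ι : Type*} (s : Finset ι) (good : ι → Prop)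
    {K Λ J₁ PEG π PE : ℝ} {w γ g : ι → ℝ} (hK : 0 ≤ K) (hΛ : 0 ≤ Λ)
    (hw : ∀ i ∈ s, 0 ≤ w i)
    (hw0 : ∀ i ∈ s, ¬ good i → w i = 0)
    (hpt : ∀ i ∈ s, good i → K * g i ≤ Λ * γ i)
    (h1 : PEG - J₁ * π ≤ ∑ i ∈ s, w i * g i) (h2 : ∑ i ∈ s, w i * γ i ≤ PE) :
    K * (PEG - J₁ * π) ≤ Λ * PE := by
  have hsum : ∑ i ∈ s, w i * (K * g i) ≤ ∑ i ∈ s, w i * (Λ * γ i) := by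
    refine Finset.sum_le_sum fun i hi => ?_
    by_cases hgi : good i
    · exact mul_le_mul_of_nonneg_left (hpt i hi hgi) (hw i hi)
    · rw [hw0 i hi hgi]; simp
  have hL : ∑ i ∈ s, w i * (K * g i) = K * ∑ i ∈ s, w i * g i := by
    rw [Finset.mul_sum]; exact Finset.sum_congr rfl fun i _ => by ring
  have hR : ∑ i ∈ s, w i * (Λ * γ i) = Λ * ∑ i ∈ s, w i * γ i := by
    rw [Finset.mul_sum]; exact Finset.sum_congr rfl fun i _ => by ring
  rw [hL, hR] at hsum
  calc K * (PEG - J₁ * π) ≤ K * ∑ i ∈ s, w i * g i := mul_le_mul_of_nonneg_left h1 hK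
    _ ≤ Λ * ∑ i ∈ s, w i * γ i := hsum
    _ ≤ Λ * PE := mul_le_mul_of_nonneg_left h2 hΛ

/-- **UPPER TAIL DECOUPLING AT FINITE VOLUME**: with the scales and events of `sq_mul_max_mul_max_le_real_inter_rider_mul_oneArmProb` (part III) and
`J ≤ 1`:  `ϰ²(1 − J)·(P(E ∩ G ∩ A_n) − J₁π_p(n))·π_p(n) ≤ (ϰ²(1 − J)·J·π_p(n) + P(G ∩ A_n))·P(E ∩ A_n)`.
[cite: Kesten1986, §2 eq. (22), Lemma (23)] [cite: BasuSapozhnikov2017ECP, §2 (2.5)–(2.8)] -/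
theorem sq_mul_mul_sub_le_real_inter_rider (p : unitInterval) {ϰ : ℝ} (hϰ : 0 < ϰ)
    {σ τ : ℕ → ℕ} (hσ : ∀ m : ℕ, 1 ≤ m → m < σ m) (hστ : ∀ m : ℕ, 1 ≤ m → σ m < τ m)
    (hσm : Monotone σ) (hτm : Monotone τ)
    (hA2 : ∀ m : ℕ, 1 ≤ m → ∀ Z : Finset (Site d), box d (τ m) \ box d (m - 1) ⊆ Z →
      ∀ X : Finset (Site d), X ⊆ Z ∩ box d m → ∀ Y : Finset (Site d), Y ⊆ Z \ box d (τ m) →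
        ϰ * (bondPercolation (zdGraph d) p).real {ω | ∃ x ∈ X, ∃ s ∈ innerBoundary (zdGraph d) (box d (σ m)),
              ω ∈ openConnIn (↑Z : Set (Site d)) x s} *
          (bondPercolation (zdGraph d) p).real {ω | ∃ y ∈ Y, ∃ s ∈ innerBoundary (zdGraph d) (box d (σ m)),
              ω ∈ openConnIn (↑Z : Set (Site d)) y s} ≤
        (bondPercolation (zdGraph d) p).real {ω | ∃ x ∈ X, ∃ y ∈ Y, ω ∈ openConnIn (↑Z : Set (Site d)) x y})
    {m₁ m₂ μ₁ μ₂ M₁ M₂ n : ℕ} (hm₁ : 1 ≤ m₁) (hm₁₂ : m₁ ≤ m₂) (h12 : τ m₁ < σ m₂)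
    (hmμ : τ (σ m₂ + 1) + 2 ≤ σ μ₁) (hμ12 : τ μ₁ < σ μ₂) (hμM : μ₂ ≤ M₁) (hM12 : τ M₁ < σ M₂) (hn : τ M₂ < n)
    (hJ : ϰ⁻¹ ^ 2 * ((bondPercolation (zdGraph d) p).real (boxCrossing d (σ μ₁) (σ μ₂)) +
        (bondPercolation (zdGraph d) p).real (boxCrossing d (σ M₁) (σ M₂))) ≤ 1)
    {E : Set (BondConfig (Site d))} {F : Finset (Sym2 (Site d))} (hE : DeterminedBy E ↑F) (hF : F ⊆ (box d (σ m₁)).sym2)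
    {G : Set (BondConfig (Site d))} {S : Finset (Sym2 (Site d))} (hG : DeterminedBy G ↑S)
    (hS : Disjoint S (box d (σ M₂ + 1)).sym2) :
    ϰ ^ 2 * (1 - ϰ⁻¹ ^ 2 * ((bondPercolation (zdGraph d) p).real (boxCrossing d (σ μ₁) (σ μ₂)) +
        (bondPercolation (zdGraph d) p).real (boxCrossing d (σ M₁) (σ M₂)))) *
      ((bondPercolation (zdGraph d) p).real (E ∩ G ∩ siteToBoundary d n) -
        ϰ⁻¹ ^ 2 * (bondPercolation (zdGraph d) p).real (boxCrossing d (σ m₁) (σ m₂)) * oneArmProb d p n) * oneArmProb d p n ≤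
      (ϰ ^ 2 * (1 - ϰ⁻¹ ^ 2 * ((bondPercolation (zdGraph d) p).real (boxCrossing d (σ μ₁) (σ μ₂)) +
          (bondPercolation (zdGraph d) p).real (boxCrossing d (σ M₁) (σ M₂)))) *
        (ϰ⁻¹ ^ 2 * ((bondPercolation (zdGraph d) p).real (boxCrossing d (σ μ₁) (σ μ₂)) +
          (bondPercolation (zdGraph d) p).real (boxCrossing d (σ M₁) (σ M₂)))) * oneArmProb d p n +
        (bondPercolation (zdGraph d) p).real (G ∩ siteToBoundary d n)) *
      (bondPercolation (zdGraph d) p).real (E ∩ siteToBoundary d n) := by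
  classical
  have hσ1 := hσ m₁ hm₁
  have hστ1 := hστ m₁ hm₁
  have hσ2 := hσ m₂ (by omega)
  have hστ2 := hστ m₂ (by omega)
  have hm : 1 ≤ σ m₂ + 1 := by omega
  have hσ0 := hσ (σ m₂ + 1) hm
  have hστ0 := hστ (σ m₂ + 1) hm
  have hmμ' : σ m₂ + 1 < μ₁ := hσm.reflect_lt (by omega)
  have hσμ1 := hσ μ₁ (by omega)
  have hστμ1 := hστ μ₁ (by omega)
  have hμ12' : μ₁ < μ₂ := hσm.reflect_lt (by omega)
  have hσμM : σ μ₂ ≤ σ M₁ := hσm hμM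
  have hσM1 := hσ M₁ (by omega)
  have hστM1 := hστ M₁ (by omega)
  have hM12' : M₁ < M₂ := hσm.reflect_lt (by omega)
  have hστM2 := hστ M₂ (by omega)
  have hτm2 : τ m₂ ≤ τ (σ m₂ + 1) := hτm (by omega)
  have hn₁ : τ m₂ < n := by omega
  set P := bondPercolation (zdGraph d) p with hP
  set J := ϰ⁻¹ ^ 2 * (P.real (boxCrossing d (σ μ₁) (σ μ₂)) + P.real (boxCrossing d (σ M₁) (σ M₂))) with hJdef
  have hJ0 : 0 ≤ J := by positivity
  have h0H : (∅ : Finset (Site d)) ⊆ box d (m₁ - 1) := Finset.empty_subset _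
  have h0X : ({0} : Finset (Site d)) ⊆ box d m₁ := Finset.singleton_subset_iff.2 (zero_mem_box d m₁)
  have h0XH : ∀ x ∈ ({0} : Finset (Site d)), x ∉ (∅ : Finset (Site d)) := fun x _ => Finset.notMem_empty x
  have hS₁ : Disjoint S (box d (σ m₂ + 1)).sym2 :=
    hS.mono_right (Finset.sym2_mono (box_mono d (by omega)))
  have hlev := sum_real_level_two_sided_aspect p hϰ hσ hστ hA2 hm₁ hm₁₂ h12 hn₁ h0H h0X h0XH hE hF
  have hlevr := sum_real_level_two_sided_aspect_rider p hϰ hσ hστ hA2 hm₁ hm₁₂ h12 hn₁ h0H h0X h0XH hE hF hG hS₁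
  have hπ : P.real (siteToBoundary d n) = oneArmProb d p n := rfl
  rw [conn_empty_zero_eq, hπ] at hlev hlevr
  have hπ0 : 0 ≤ oneArmProb d p n := by rw [← hπ]; exact measureReal_nonneg
  have hK : 0 ≤ ϰ ^ 2 * (1 - J) * oneArmProb d p n := mul_nonneg (mul_nonneg (pow_pos hϰ 2).le (by linarith)) hπ0
  have hΛ : 0 ≤ ϰ ^ 2 * (1 - J) * J * oneArmProb d p n + P.real (G ∩ siteToBoundary d n) :=
    add_nonneg (mul_nonneg (mul_nonneg (mul_nonneg (pow_pos hϰ 2).le (by linarith)) hJ0) hπ0) measureReal_nonneg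
  have key := level_one_upper_of_pointwise
    (((box d (σ m₂)).powerset.filter (fun U => box d (σ m₁) ⊆ U)) ×ˢ (box d (σ m₂ + 1)).powerset)
    (fun C => ∀ r ∈ C.2, r ∉ box d (σ m₂)) hK hΛ ?_ ?_ ?_ hlevr.1 hlev.2
  · calc ϰ ^ 2 * (1 - J) * (P.real (E ∩ G ∩ siteToBoundary d n) -
          ϰ⁻¹ ^ 2 * P.real (boxCrossing d (σ m₁) (σ m₂)) * oneArmProb d p n) * oneArmProb d p n
        = ϰ ^ 2 * (1 - J) * oneArmProb d p n * (P.real (E ∩ G ∩ siteToBoundary d n) -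
          ϰ⁻¹ ^ 2 * P.real (boxCrossing d (σ m₁) (σ m₂)) * oneArmProb d p n) := by ring
      _ ≤ _ := key
  · exact fun _ _ => measureReal_nonneg
  · intro C hC hbad
    push Not at hbad
    obtain ⟨r, hr, hrb⟩ := hbad
    rw [Finset.mem_product, Finset.mem_filter, Finset.mem_powerset, Finset.mem_powerset] at hC
    exact le_antisymm ((measureReal_mono (fun ω hω => hω.1.1.2) (measure_ne_top _ _)).trans
      (real_dat_eq_zero_of_mem_box p (by omega : σ m₁ ≤ σ m₂) hC.1.1 hr hrb).le) measureReal_nonneg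
  · intro C hC hgood
    rw [Finset.mem_product, Finset.mem_filter, Finset.mem_powerset, Finset.mem_powerset] at hC
    have hH' : C.1 ⊆ box d (σ m₂ + 1 - 1) := by rw [Nat.add_sub_cancel]; exact hC.1.1
    have hup := sq_mul_le_real_rider_siteToBoundary_mul_conn p hϰ hσ hστ hσm hτm hA2 hm hmμ hμ12 hμM hM12 hn hH' hC.2
      (fun x hx hxU => hgood x hx (hC.1.1 hxU)) hG hS
    have hmax := mul_le_mul_of_nonneg_left (le_max_right (0 : ℝ)
      (P.real (G ∩ {ω : BondConfig (Site d) | ∃ x ∈ C.2, ∃ t ∈ innerBoundary (zdGraph d) (box d n),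
            ω ∈ openConnIn ((↑(box d n) : Set (Site d)) \ ↑C.1) x t}) -
        J * P.real {ω : BondConfig (Site d) | ∃ x ∈ C.2, ∃ t ∈ innerBoundary (zdGraph d) (box d n),
            ω ∈ openConnIn ((↑(box d n) : Set (Site d)) \ ↑C.1) x t})) hK
    nlinarith [hmax, hup]

end Summit.CriticalPhenomena.PercolationContinuityZ3.Theorems.Crossing

end
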